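import Mathlib
import HarnessLib

/-!
# HANDOFF — THE INERTIA COUNT: the number of negative eigenvalues of a real symmetric form from subspace certificates
# (cell rh-explicit, TRACK «HANDOFF», seat theory-2 gen12; FILE XII-y; finite-dimensional folklore on top of Mathlib's `sigNeg`)

HONEST FRAMING. Nothing in this file bears on the truth of RH; every statement is elementary real linear algebra (Sylvester's law
of inertia / Courant–Fischer / the finite-dimensional Birman–Schwinger principle, all folklore). It types the COUNTING sentence the
cell's ladder data uses (theory-2 gen11 LADDER note (L1)–(L2), DERIVED-CHECK single-lineage on cc-s2-3's certified cc6-hp case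
files and cc-s2-5's rank-one-lift certificates, q = 5 … 43): «the q-deleted window section `G_S = G_F − N` has EXACTLY ONE negative
eigenvalue: `N₋(G_S) = #{μ_j > 1}` for the Birman–Schwinger eigenvalues `μ_j` of `G_F⁻¹N`, and μ₁ > 1 ⟺ negative (66/66) while
μ₂ ≤ 0.14 (66/66); equivalently a certified-PSD rank-one LIFT plus a certified ε₁ < 0 gives INERTIA 1». XII-x
(`HandoffSecularPencil`) typed only the index-≤-1 case by hand («no two orthogonal negative eigenvectors»); here the count is
done for every codimension and identified with the eigenvalue count, using Mathlib's negative index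
`sigNeg Q` = the largest dimension of a subspace on which `Q` is negative definite (`Mathlib.LinearAlgebra.QuadraticForm.Signature`).
§1 `x ↦ x·(M x)` is `Matrix.toQuadraticForm' M`; `sigNeg + dim W ≤ n` for every subspace `W` on which the form is `≥ 0`
   (`sigNeg_add_finrank_le`, = Mathlib's `sigPos_add_finrank_le_of_nonpos` for `−Q`); one negative vector gives `sigNeg ≥ 1`.
§2 `k` pairwise-orthogonal non-zero eigenvectors with negative eigenvalues span a `k`-dimensional negative-definite subspace
   (`card_le_sigNeg_of_orthogonal_eigenvectors`), hence `k + dim W ≤ n` (`card_orthogonal_negative_eigenvectors_add_finrank_le`: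
   XII-x's theorem is `k = 2`, `codim W = 1`).
§3 CERTIFICATES: the joint orthogonal complement of `m` vectors has codimension `≤ m` (rank–nullity), so «form ≥ 0 there ⟹
   sigNeg ≤ m» (`sigNeg_le_of_nonneg_on_ker`); instances: the rank-`m` LIFT certificate `G + Σ tᵢuᵢuᵢᵀ ⪰ 0 ⟹ sigNeg G ≤ m`
   (`sigNeg_le_of_lift`) and the variational Birman–Schwinger clause «`N ≤ A` off `m` vectors ⟹ sigNeg(A − N) ≤ m»
   (`sigNeg_sub_le_of_le_on_ker`; `m = 1` is «μ₂ ≤ 1»).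
§4 WITH THE SPECTRAL THEOREM (Mathlib's `Matrix.IsHermitian.eigenvectorBasis`): for any dot-orthonormal eigen-family,
   `sigNeg = #{i | λᵢ < 0}` (`sigNeg_eq_card_of_orthonormal_eigenvectors`, `sigNeg_eq_card_eigenvalues_neg`) — so every §3
   bound is a bound on the NUMBER OF NEGATIVE EIGENVALUES WITH MULTIPLICITY; in particular «INERTIA 1 CERTIFIED»:
   rank-one lift PSD + one negative vector ⟹ exactly one negative eigenvalue (`card_eigenvalues_neg_eq_one_of_lift`), and
   «μ₂ ≤ 1 + ε₁ < 0 ⟹ exactly one» (`card_eigenvalues_neg_sub_eq_one`).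
§5 BIRMAN–SCHWINGER PROPER: the index is a congruence invariant (`sigNeg_conj`, via `QuadraticMap.Equivalent.sigNeg_eq`); if
   `CᵀAC = 1` then `Cᵀ(A − N)C = 1 − CᵀNC`, so `sigNeg(A − N) = #{i | κᵢ > 1}` for the eigenvalues `κᵢ` of `K = CᵀNC`
   (`sigNeg_sub_eq_card_of_conj`, `…_eigenvalues_gt_one`, `card_eigenvalues_neg_sub_eq_card_gt_one`), and `K` has the same
   characteristic polynomial as `A⁻¹N` (`charpoly_conj_eq_charpoly_inv_mul`): the `κᵢ` are the `μⱼ` of kappa.py's `G_F⁻¹N`.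
What is NOT here (DATA/MODEL, not kernel): the values μ₂ ∈ [0.059, 0.139], the law μ₂·q^{1/3} ≈ const, the identification of
the cell's matrices with any Weil-form section (that is the case files' content), anything infinite-dimensional, anything about ζ.
No `def`s: the objects are Mathlib's (`Matrix.toQuadraticForm'`, `sigNeg`, `Matrix.IsHermitian.eigenvalues`). References
(folklore): J. J. Sylvester, Philos. Mag. 4 (1852) 138–142; R. Courant, Math. Z. 7 (1920) 1–57; M. Sh. Birman, Mat. Sb. 55 (1961)
125–174; J. Schwinger, Proc. Nat. Acad. Sci. 47 (1961) 122–129 — as read in standard texts (Horn–Johnson, Matrix Analysis,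
Thm 4.5.8; Reed–Simon IV §XIII.3). Companions: XII-l `HandoffRankOnePencil`, XII-x `HandoffSecularPencil`, XII-x′ `HandoffSecularGaps`.
-/

set_option linter.dupNamespace false  -- the mandated namespace repeats `RiemannHypothesis`

open Matrix Finset Module QuadraticMap

namespace Summit.RiemannHypothesis.RiemannHypothesis.Theorems.HandoffInertiaCount

variable {n : Type*} [Fintype n] [DecidableEq n]

/-! ## §1 The quadratic form of a matrix, and Mathlib's negative index `sigNeg` -/

/-- The quadratic form `Matrix.toQuadraticForm' M` of a real square matrix is `x ↦ x·(M x)`. [folklore] -/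
theorem toQuadraticForm'_apply (M : Matrix n n ℝ) (x : n → ℝ) : M.toQuadraticForm' x = x ⬝ᵥ M *ᵥ x := by
  simp [Matrix.toQuadraticForm', LinearMap.BilinMap.toQuadraticMap_apply, Matrix.toLinearMap₂'_apply']

/-- **INDEX + (dimension of a non-negative subspace) ≤ n.** If `x ↦ x·(M x)` is `≥ 0` on a subspace `W` of `ℝⁿ`, then
Mathlib's negative index `sigNeg` (the largest dimension of a negative-definite subspace) satisfies `sigNeg + dim W ≤ n` — a
negative-definite subspace meets a non-negative one only in `0` (the dimension count behind Sylvester / Courant–Fischer; Mathlib's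
`QuadraticForm.sigPos_add_finrank_le_of_nonpos` for `−Q`). [folklore] -/
theorem sigNeg_add_finrank_le (M : Matrix n n ℝ) (W : Submodule ℝ (n → ℝ)) (hW : ∀ x ∈ W, 0 ≤ x ⬝ᵥ M *ᵥ x) :
    sigNeg M.toQuadraticForm' + finrank ℝ W ≤ Fintype.card n := by
  have h := QuadraticForm.sigPos_add_finrank_le_of_nonpos (Q := -M.toQuadraticForm') (V := W)
    (fun x hx ↦ by simpa [toQuadraticForm'_apply] using hW x hx)
  simpa [finrank_fintype_fun_eq_card] using h

/-- A vector on which the form is negative already gives index `≥ 1` (the line it spans is negative definite). [folklore] -/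
theorem one_le_sigNeg_of_neg (M : Matrix n n ℝ) {x : n → ℝ} (hx : x ⬝ᵥ M *ᵥ x < 0) : 1 ≤ sigNeg M.toQuadraticForm' := by
  have hx0 : x ≠ 0 := by
    rintro rfl
    simp at hx
  have hV : ((-M.toQuadraticForm').restrict (ℝ ∙ x)).PosDef := by
    intro v hv
    obtain ⟨a, ha⟩ := Submodule.mem_span_singleton.mp v.2
    have ha0 : a ≠ 0 := by
      rintro rfl
      apply hv
      ext1
      simp [← ha]
    rw [restrict_apply, QuadraticMap.neg_apply, toQuadraticForm'_apply, ← ha, mulVec_smul, dotProduct_smul, smul_dotProduct, smul_eq_mul,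
      smul_eq_mul, neg_pos]
    nlinarith [mul_pos (mul_self_pos.mpr ha0) (neg_pos.mpr hx)]
  have h := le_sigNeg_of_negDef M.toQuadraticForm' hV
  rwa [finrank_span_singleton hx0] at h

/-! ## §2 Pairwise-orthogonal eigenvectors with negative eigenvalues count toward the index -/

section Orthogonal
variable {ι : Type*} [Fintype ι]

omit [DecidableEq n] in
/-- Pairwise-orthogonal non-zero vectors of `ℝⁿ` (for the dot product) are linearly independent. [folklore] -/
theorem linearIndependent_of_dotProduct_eq_zero (x : ι → (n → ℝ)) (hx : ∀ i, x i ≠ 0)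
    (horth : ∀ i j, i ≠ j → x i ⬝ᵥ x j = 0) : LinearIndependent ℝ x := by
  classical
  rw [Fintype.linearIndependent_iff]
  intro g hg i
  have h := congrArg (fun v ↦ x i ⬝ᵥ v) hg
  simp only [dotProduct_sum, dotProduct_smul, smul_eq_mul, dotProduct_zero] at h
  rw [Finset.sum_eq_single i (fun j _ hji ↦ by rw [horth i j (Ne.symm hji), mul_zero])
    (fun hi ↦ absurd (Finset.mem_univ i) hi)] at h
  have hpos : 0 < x i ⬝ᵥ x i := by simpa using dotProduct_star_self_pos_iff.mpr (hx i)
  exact (mul_eq_zero.mp h).resolve_right hpos.ne'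

omit [DecidableEq n] in
/-- The form on a combination of pairwise-orthogonal eigenvectors: if `M xᵢ = λᵢ xᵢ` and `xᵢ·xⱼ = 0` for `i ≠ j`, then
`(Σᵢ cᵢxᵢ)·M(Σᵢ cᵢxᵢ) = Σᵢ cᵢ² λᵢ (xᵢ·xᵢ)` — the cross terms die. (No symmetry of `M` is used.) [folklore] -/
theorem dotProduct_mulVec_combination (M : Matrix n n ℝ) (x : ι → (n → ℝ)) (lam : ι → ℝ)
    (hMx : ∀ i, M *ᵥ x i = lam i • x i) (horth : ∀ i j, i ≠ j → x i ⬝ᵥ x j = 0) (c : ι → ℝ) :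
    (∑ i, c i • x i) ⬝ᵥ M *ᵥ (∑ i, c i • x i) = ∑ i, c i ^ 2 * lam i * (x i ⬝ᵥ x i) := by
  classical
  have hM : M *ᵥ (∑ i, c i • x i) = ∑ i, (c i * lam i) • x i := by
    rw [← mulVecLin_apply, map_sum]
    refine Finset.sum_congr rfl fun i _ ↦ ?_
    rw [map_smul, mulVecLin_apply, hMx i, smul_smul]
  rw [hM, sum_dotProduct]
  refine Finset.sum_congr rfl fun i _ ↦ ?_
  rw [dotProduct_sum, Finset.sum_eq_single i (fun j _ hji ↦ ?_) (fun hi ↦ absurd (Finset.mem_univ i) hi)]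
  · rw [smul_dotProduct, dotProduct_smul, smul_eq_mul, smul_eq_mul]
    ring
  · rw [smul_dotProduct, dotProduct_smul, horth i j (Ne.symm hji), smul_zero, smul_zero]

omit [DecidableEq n] in
/-- **NEGATIVE-DEFINITE SPAN.** Pairwise-orthogonal non-zero eigenvectors with negative eigenvalues span a subspace on which the
form `x ↦ x·(M x)` is negative at every non-zero vector. [folklore] -/
theorem neg_on_span_of_orthogonal_eigenvectors (M : Matrix n n ℝ) (x : ι → (n → ℝ)) (lam : ι → ℝ) (hx : ∀ i, x i ≠ 0)
    (hMx : ∀ i, M *ᵥ x i = lam i • x i) (horth : ∀ i j, i ≠ j → x i ⬝ᵥ x j = 0) (hlam : ∀ i, lam i < 0)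
    {v : n → ℝ} (hv : v ∈ Submodule.span ℝ (Set.range x)) (hv0 : v ≠ 0) : v ⬝ᵥ M *ᵥ v < 0 := by
  classical
  obtain ⟨c, rfl⟩ := (Submodule.mem_span_range_iff_exists_fun (R := ℝ)).mp hv
  rw [dotProduct_mulVec_combination M x lam hMx horth c]
  obtain ⟨i, hi⟩ : ∃ i, c i ≠ 0 := by
    by_contra h
    push Not at h
    exact hv0 (by simp [h])
  have hterm : ∀ j, c j ^ 2 * lam j * (x j ⬝ᵥ x j) ≤ 0 := fun j ↦
    mul_nonpos_of_nonpos_of_nonneg (mul_nonpos_of_nonneg_of_nonpos (sq_nonneg _) (hlam j).le)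
      (by simpa using dotProduct_star_self_nonneg (x j))
  have hpos : 0 < x i ⬝ᵥ x i := by simpa using dotProduct_star_self_pos_iff.mpr (hx i)
  have hi' : c i ^ 2 * lam i * (x i ⬝ᵥ x i) < 0 := mul_neg_of_neg_of_pos (mul_neg_of_pos_of_neg (by positivity) (hlam i)) hpos
  rw [← Finset.add_sum_erase _ _ (Finset.mem_univ i)]
  exact add_neg_of_neg_of_nonpos hi' (Finset.sum_nonpos fun j _ ↦ hterm j)

/-- **k ORTHOGONAL NEGATIVE EIGEN-DIRECTIONS ⟹ INDEX ≥ k.** If `M` has `k = |ι|` pairwise-orthogonal non-zero eigenvectors with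
negative eigenvalues, then `k ≤ sigNeg` of the form `x ↦ x·(M x)` (their span is a `k`-dimensional negative-definite subspace).
[folklore] -/
theorem card_le_sigNeg_of_orthogonal_eigenvectors (M : Matrix n n ℝ) (x : ι → (n → ℝ)) (lam : ι → ℝ) (hx : ∀ i, x i ≠ 0)
    (hMx : ∀ i, M *ᵥ x i = lam i • x i) (horth : ∀ i j, i ≠ j → x i ⬝ᵥ x j = 0) (hlam : ∀ i, lam i < 0) :
    Fintype.card ι ≤ sigNeg M.toQuadraticForm' := by
  classical
  have hV : ((-M.toQuadraticForm').restrict (Submodule.span ℝ (Set.range x))).PosDef := by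
    intro v hv
    have hv0 : (v : n → ℝ) ≠ 0 := fun h ↦ hv ((Submodule.coe_eq_zero).mp h)
    rw [restrict_apply, QuadraticMap.neg_apply, toQuadraticForm'_apply, neg_pos]
    exact neg_on_span_of_orthogonal_eigenvectors M x lam hx hMx horth hlam v.2 hv0
  have h := le_sigNeg_of_negDef M.toQuadraticForm' hV
  rwa [finrank_span_eq_card (linearIndependent_of_dotProduct_eq_zero x hx horth)] at h

/-- **THE INERTIA COUNT (upper clause).** If the form `x ↦ x·(M x)` is `≥ 0` on a subspace `W`, then the number `k` of
pairwise-orthogonal non-zero eigenvectors of `M` with negative eigenvalues obeys `k + dim W ≤ n`, i.e. `k ≤ codim W` («non-negative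
on codimension m ⟹ at most m negative directions»; `codim W = 1` is XII-x's `not_two_orthogonal_negative_eigenvectors`). [folklore] -/
theorem card_orthogonal_negative_eigenvectors_add_finrank_le (M : Matrix n n ℝ) (W : Submodule ℝ (n → ℝ))
    (hW : ∀ x ∈ W, 0 ≤ x ⬝ᵥ M *ᵥ x) (x : ι → (n → ℝ)) (lam : ι → ℝ) (hx : ∀ i, x i ≠ 0)
    (hMx : ∀ i, M *ᵥ x i = lam i • x i) (horth : ∀ i j, i ≠ j → x i ⬝ᵥ x j = 0) (hlam : ∀ i, lam i < 0) :
    Fintype.card ι + finrank ℝ W ≤ Fintype.card n :=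
  (Nat.add_le_add_right (card_le_sigNeg_of_orthogonal_eigenvectors M x lam hx hMx horth hlam) _).trans
    (sigNeg_add_finrank_le M W hW)

end Orthogonal

/-! ## §3 Certificates: the joint orthogonal complement of m vectors has codimension ≤ m -/

section Certificates
variable {m : ℕ}

omit [DecidableEq n] in
/-- Rank–nullity for the certificate subspace: the joint orthogonal complement `{x | U x = 0}` of the `m` rows of
`U : Matrix (Fin m) n ℝ` has dimension `≥ n − m`, i.e. `n ≤ dim ker U + m`. [folklore] -/
theorem card_le_finrank_ker_add (U : Matrix (Fin m) n ℝ) :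
    Fintype.card n ≤ finrank ℝ (LinearMap.ker U.mulVecLin) + m := by
  have h := LinearMap.finrank_range_add_finrank_ker U.mulVecLin
  have hr : finrank ℝ (LinearMap.range U.mulVecLin) ≤ m := by
    simpa using Submodule.finrank_le (LinearMap.range U.mulVecLin)
  rw [finrank_fintype_fun_eq_card] at h
  omega

/-- **INDEX ≤ m FROM A CODIMENSION-m CERTIFICATE.** If `x·(M x) ≥ 0` for every `x` orthogonal to the `m` rows of `U`
(`U x = 0`), then `sigNeg ≤ m`. (`m = 1`: non-negative on a hyperplane ⟹ at most one negative direction.) [folklore] -/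
theorem sigNeg_le_of_nonneg_on_ker (M : Matrix n n ℝ) (U : Matrix (Fin m) n ℝ)
    (h : ∀ x, U *ᵥ x = 0 → 0 ≤ x ⬝ᵥ M *ᵥ x) : sigNeg M.toQuadraticForm' ≤ m := by
  have h1 := sigNeg_add_finrank_le M (LinearMap.ker U.mulVecLin)
    (fun x hx ↦ h x (by simpa [LinearMap.mem_ker] using hx))
  have h2 := card_le_finrank_ker_add U
  omega

/-- A sum of `m` rank-one matrices `tᵢ·uᵢuᵢᵀ` kills every vector orthogonal to all `uᵢ`. [folklore] -/
theorem sum_vecMulVec_mulVec_eq_zero (U : Matrix (Fin m) n ℝ) (t : Fin m → ℝ) {x : n → ℝ} (hx : U *ᵥ x = 0) :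
    (∑ i, t i • vecMulVec (U i) (U i)) *ᵥ x = 0 := by
  rw [← mulVecLin_apply, show (∑ i, t i • vecMulVec (U i) (U i)).mulVecLin = ∑ i, (t i • vecMulVec (U i) (U i)).mulVecLin
    from by ext; simp, LinearMap.sum_apply]
  refine Finset.sum_eq_zero fun i _ ↦ ?_
  have hi : U i ⬝ᵥ x = 0 := by simpa [Matrix.mulVec, dotProduct] using congr_fun hx i
  rw [mulVecLin_apply, smul_mulVec, Matrix.vecMulVec_mulVec, op_smul_eq_smul, hi, zero_smul, smul_zero]

/-- **THE RANK-m LIFT CERTIFICATE** (cc-s2-5's «rank-one-lift inertia certificate», any rank): if `G + Σᵢ tᵢ·uᵢuᵢᵀ` is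
non-negative as a form (e.g. its `λ_min` is CERTIFIED `≥ 0`), then `G` is `≥ 0` on the joint orthogonal complement of the `uᵢ`,
hence `sigNeg(G) ≤ m` (a rank-`m` modification moves the index by at most `m`). [folklore] -/
theorem sigNeg_le_of_lift (G : Matrix n n ℝ) (U : Matrix (Fin m) n ℝ) (t : Fin m → ℝ)
    (hlift : ∀ x : n → ℝ, 0 ≤ x ⬝ᵥ (G + ∑ i, t i • vecMulVec (U i) (U i)) *ᵥ x) : sigNeg G.toQuadraticForm' ≤ m := by
  refine sigNeg_le_of_nonneg_on_ker G U fun x hx ↦ ?_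
  have h := hlift x
  rwa [add_mulVec, sum_vecMulVec_mulVec_eq_zero U t hx, add_zero] at h

/-- **BIRMAN–SCHWINGER, VARIATIONAL FORM («μ_{m+1} ≤ 1»).** If `x·Nx ≤ x·Ax` for every `x` orthogonal to `m` given vectors
(the rows of `U`), then `A − N` has `sigNeg ≤ m` (`m = 1`: «second Birman–Schwinger eigenvalue ≤ 1 ⟹ at most one negative
direction»; the lower clause is `one_le_sigNeg_of_neg`). [folklore] -/
theorem sigNeg_sub_le_of_le_on_ker (A N : Matrix n n ℝ) (U : Matrix (Fin m) n ℝ)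
    (h : ∀ x, U *ᵥ x = 0 → x ⬝ᵥ N *ᵥ x ≤ x ⬝ᵥ A *ᵥ x) : sigNeg (A - N).toQuadraticForm' ≤ m := by
  refine sigNeg_le_of_nonneg_on_ker _ U fun x hx ↦ ?_
  rw [sub_mulVec, dotProduct_sub, sub_nonneg]
  exact h x hx

end Certificates

/-! ## §4 With the spectral theorem: the index IS the number of negative eigenvalues -/

section Count
/-- **sigNeg = #{negative eigenvalues}.** If `e : n → ℝⁿ` is a dot-orthonormal family of eigenvectors of `M` (`eᵢ·eⱼ = δᵢⱼ`,
`M eᵢ = λᵢ eᵢ`; e.g. the spectral theorem's eigenbasis of a symmetric `M`), then the negative index of `x ↦ x·(M x)` is exactly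
the number of indices with `λᵢ < 0`: `≥` because those `eᵢ` span a negative-definite subspace (§2), `≤` because the others span
a non-negative subspace of the complementary dimension (§1) — Sylvester / Courant–Fischer for the count. [folklore] -/
theorem sigNeg_eq_card_of_orthonormal_eigenvectors (M : Matrix n n ℝ) (e : n → (n → ℝ)) (lam : n → ℝ)
    (he : ∀ i j, e i ⬝ᵥ e j = if i = j then 1 else 0) (hMe : ∀ i, M *ᵥ e i = lam i • e i) :
    sigNeg M.toQuadraticForm' = Fintype.card {i // lam i < 0} := by
  classical
  have hne : ∀ i, e i ≠ 0 := fun i h ↦ by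
    have h1 := he i i
    rw [h, dotProduct_zero, if_pos rfl] at h1
    exact zero_ne_one h1
  have horth : ∀ i j, i ≠ j → e i ⬝ᵥ e j = 0 := fun i j hij ↦ by rw [he, if_neg hij]
  apply le_antisymm
  · have hW : ∀ v ∈ Submodule.span ℝ (Set.range fun i : {i // 0 ≤ lam i} ↦ e i), 0 ≤ v ⬝ᵥ M *ᵥ v := by
      intro v hv
      obtain ⟨c, rfl⟩ := (Submodule.mem_span_range_iff_exists_fun (R := ℝ)).mp hv
      rw [dotProduct_mulVec_combination M (fun i : {i // 0 ≤ lam i} ↦ e i) (fun i ↦ lam i) (fun i ↦ hMe i)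
        (fun i j hij ↦ horth i j fun h ↦ hij (Subtype.ext h)) c]
      exact Finset.sum_nonneg fun i _ ↦ mul_nonneg (mul_nonneg (sq_nonneg _) i.2) (by simpa using dotProduct_star_self_nonneg (e i.1))
    have h1 := sigNeg_add_finrank_le M _ hW
    rw [finrank_span_eq_card (linearIndependent_of_dotProduct_eq_zero (fun i : {i // 0 ≤ lam i} ↦ e i) (fun i ↦ hne i)
      fun i j hij ↦ horth i j fun h ↦ hij (Subtype.ext h))] at h1
    have hc : Fintype.card {i // lam i < 0} + Fintype.card {i // 0 ≤ lam i} = Fintype.card n := by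
      rw [Fintype.card_subtype, Fintype.card_subtype, ← Finset.card_univ,
        ← Finset.card_filter_add_card_filter_not (s := (Finset.univ : Finset n)) (fun i ↦ lam i < 0)]
      congr 2
      exact Finset.filter_congr fun i _ ↦ by rw [not_lt]
    omega
  · exact card_le_sigNeg_of_orthogonal_eigenvectors M (fun i : {i // lam i < 0} ↦ e i) (fun i ↦ lam i) (fun i ↦ hne i)
      (fun i ↦ hMe i) (fun i j hij ↦ horth i j fun h ↦ hij (Subtype.ext h)) fun i ↦ i.2

/-- Mathlib's orthonormal eigenvector basis of a real symmetric matrix is dot-orthonormal as a family in `ℝⁿ`. [folklore] -/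
theorem eigenvectorBasis_dotProduct {M : Matrix n n ℝ} (hM : M.IsHermitian) (i j : n) :
    (⇑(hM.eigenvectorBasis i) : n → ℝ) ⬝ᵥ ⇑(hM.eigenvectorBasis j) = if i = j then 1 else 0 := by
  have h := (orthonormal_iff_ite.mp hM.eigenvectorBasis.orthonormal) i j
  rw [EuclideanSpace.inner_eq_star_dotProduct, star_trivial, dotProduct_comm] at h
  exact h

/-- **THE NUMBER OF NEGATIVE EIGENVALUES OF A REAL SYMMETRIC MATRIX IS ITS NEGATIVE INDEX**: with Mathlib's spectral-theorem
eigenvalues `hM.eigenvalues : n → ℝ` (listed with multiplicity on the index type `n`),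
`sigNeg (x ↦ x·Mx) = #{i | hM.eigenvalues i < 0}`. [folklore: Sylvester's law of inertia] -/
theorem sigNeg_eq_card_eigenvalues_neg {M : Matrix n n ℝ} (hM : M.IsHermitian) :
    sigNeg M.toQuadraticForm' = Fintype.card {i // hM.eigenvalues i < 0} :=
  sigNeg_eq_card_of_orthonormal_eigenvectors M (fun i ↦ ⇑(hM.eigenvectorBasis i)) hM.eigenvalues
    (eigenvectorBasis_dotProduct hM) fun i ↦ hM.mulVec_eigenvectorBasis i

/-- Courant–Fischer, counting form: a real symmetric matrix whose form is `≥ 0` on a subspace `W` has at most `codim W` negative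
eigenvalues (with multiplicity). [folklore] -/
theorem card_eigenvalues_neg_add_finrank_le {M : Matrix n n ℝ} (hM : M.IsHermitian) (W : Submodule ℝ (n → ℝ))
    (hW : ∀ x ∈ W, 0 ≤ x ⬝ᵥ M *ᵥ x) : Fintype.card {i // hM.eigenvalues i < 0} + finrank ℝ W ≤ Fintype.card n := by
  rw [← sigNeg_eq_card_eigenvalues_neg hM]
  exact sigNeg_add_finrank_le M W hW

variable {m : ℕ}

/-- At most `m` negative eigenvalues when the form is `≥ 0` on the joint orthogonal complement of `m` vectors. [folklore] -/
theorem card_eigenvalues_neg_le_of_nonneg_on_ker {M : Matrix n n ℝ} (hM : M.IsHermitian) (U : Matrix (Fin m) n ℝ)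
    (h : ∀ x, U *ᵥ x = 0 → 0 ≤ x ⬝ᵥ M *ᵥ x) : Fintype.card {i // hM.eigenvalues i < 0} ≤ m := by
  rw [← sigNeg_eq_card_eigenvalues_neg hM]
  exact sigNeg_le_of_nonneg_on_ker M U h

/-- **INERTIA ≤ m FROM A CERTIFIED RANK-m LIFT**: if `G + Σᵢ tᵢ·uᵢuᵢᵀ ⪰ 0` then the symmetric `G` has at most `m` negative
eigenvalues. [folklore] -/
theorem card_eigenvalues_neg_le_of_lift {G : Matrix n n ℝ} (hG : G.IsHermitian) (U : Matrix (Fin m) n ℝ) (t : Fin m → ℝ)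
    (hlift : ∀ x : n → ℝ, 0 ≤ x ⬝ᵥ (G + ∑ i, t i • vecMulVec (U i) (U i)) *ᵥ x) :
    Fintype.card {i // hG.eigenvalues i < 0} ≤ m := by
  rw [← sigNeg_eq_card_eigenvalues_neg hG]
  exact sigNeg_le_of_lift G U t hlift

/-- **«INERTIA 1 CERTIFIED»** (cc-s2-5's instrument, kernel form): a certified-PSD rank-ONE lift `G + t·u uᵀ ⪰ 0` together with
ONE vector of negative energy `x₀·G x₀ < 0` (e.g. a certified `λ_min(G) < 0`) forces the symmetric `G` to have EXACTLY ONE negative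
eigenvalue, counted with multiplicity. [folklore] -/
theorem card_eigenvalues_neg_eq_one_of_lift {G : Matrix n n ℝ} (hG : G.IsHermitian) (u : n → ℝ) (t : ℝ)
    (hlift : ∀ x : n → ℝ, 0 ≤ x ⬝ᵥ (G + t • vecMulVec u u) *ᵥ x) {x₀ : n → ℝ} (hx₀ : x₀ ⬝ᵥ G *ᵥ x₀ < 0) :
    Fintype.card {i // hG.eigenvalues i < 0} = 1 := by
  rw [← sigNeg_eq_card_eigenvalues_neg hG]
  refine le_antisymm (sigNeg_le_of_lift G (fun _ : Fin 1 ↦ u) (fun _ ↦ t) fun x ↦ ?_) (one_le_sigNeg_of_neg G hx₀)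
  simpa using hlift x

/-- **«μ₂ ≤ 1 AND ε₁ < 0 ⟹ EXACTLY ONE NEGATIVE EIGENVALUE»** (the LADDER note's sentence (L2), kernel form): if `x·Nx ≤ x·Ax`
for every `x` orthogonal to ONE vector `u` (variational «second Birman–Schwinger eigenvalue ≤ 1») and some `x₀` has
`x₀·(A − N)x₀ < 0` (a certified negative bottom), then the symmetric `A − N` has exactly one negative eigenvalue. [folklore] -/
theorem card_eigenvalues_neg_sub_eq_one {A N : Matrix n n ℝ} (hAN : (A - N).IsHermitian) (u : n → ℝ)
    (h : ∀ x, u ⬝ᵥ x = 0 → x ⬝ᵥ N *ᵥ x ≤ x ⬝ᵥ A *ᵥ x) {x₀ : n → ℝ} (hx₀ : x₀ ⬝ᵥ (A - N) *ᵥ x₀ < 0) :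
    Fintype.card {i // hAN.eigenvalues i < 0} = 1 := by
  rw [← sigNeg_eq_card_eigenvalues_neg hAN]
  refine le_antisymm (sigNeg_sub_le_of_le_on_ker A N (fun _ : Fin 1 ↦ u) fun x hx ↦ h x ?_) (one_le_sigNeg_of_neg _ hx₀)
  simpa [Matrix.mulVec, dotProduct, funext_iff] using hx

end Count

/-! ## §5 Congruence invariance, and the finite-dimensional Birman–Schwinger count -/

section BirmanSchwinger
omit [DecidableEq n] in
/-- Congruence: `x·(CᵀPC)x = (Cx)·P(Cx)`. [folklore] -/
theorem dotProduct_conj_mulVec (P C : Matrix n n ℝ) (x : n → ℝ) :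
    x ⬝ᵥ (Cᵀ * P * C) *ᵥ x = (C *ᵥ x) ⬝ᵥ P *ᵥ (C *ᵥ x) := by
  rw [← mulVec_mulVec, ← mulVec_mulVec, dotProduct_mulVec x Cᵀ, vecMul_transpose]

/-- **SYLVESTER: the index is a congruence invariant.** For an invertible `C`, the forms of `CᵀPC` and `P` are equivalent
(`x ↦ Cx` is an isometry), so `sigNeg(CᵀPC) = sigNeg(P)`. [folklore] -/
theorem sigNeg_conj (P C : Matrix n n ℝ) (hC : IsUnit C.det) :
    sigNeg (Cᵀ * P * C).toQuadraticForm' = sigNeg P.toQuadraticForm' := by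
  let eC : (n → ℝ) ≃ₗ[ℝ] (n → ℝ) :=
    { C.mulVecLin with
      invFun := fun y ↦ C⁻¹ *ᵥ y
      left_inv := fun x ↦ by simp [mulVec_mulVec, Matrix.nonsing_inv_mul _ hC]
      right_inv := fun y ↦ by simp [mulVec_mulVec, Matrix.mul_nonsing_inv _ hC] }
  refine QuadraticMap.Equivalent.sigNeg_eq ⟨{ eC with map_app' := fun x ↦ ?_ }⟩
  show P.toQuadraticForm' (C *ᵥ x) = (Cᵀ * P * C).toQuadraticForm' x
  rw [toQuadraticForm'_apply, toQuadraticForm'_apply, dotProduct_conj_mulVec]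

/-- If `CᵀAC = 1` then `C` is invertible. [folklore] -/
theorem isUnit_det_of_conj_eq_one {A C : Matrix n n ℝ} (hC : Cᵀ * A * C = 1) : IsUnit C.det := by
  have h := congrArg Matrix.det hC
  rw [det_mul, det_mul, det_transpose, det_one] at h
  exact IsUnit.of_mul_eq_one (A.det * C.det) (by rw [← h]; ring)

/-- **FINITE-DIMENSIONAL BIRMAN–SCHWINGER.** Let `CᵀAC = 1` (e.g. `C = A^{−1/2}`, or `C = L⁻ᵀ` from a Cholesky factor of a
positive definite `A`) and let `(eᵢ, κᵢ)` be a dot-orthonormal eigen-decomposition of the symmetric matrix `K = CᵀNC`. Then the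
number of negative eigen-directions of `A − N` is the number of `κᵢ` ABOVE 1:
`sigNeg(A − N) = #{i | 1 < κᵢ}` — because `Cᵀ(A − N)C = 1 − K` and the index is a congruence invariant; the `κᵢ` are the
Birman–Schwinger eigenvalues `μⱼ` of `A⁻¹N` (`charpoly_conj_eq_charpoly_inv_mul`). This is «N₋(G_S) = #{μ_j > 1}» of the cell's
LADDER note (L2) (`A = G_F` the full form's section, `N = G_F − G_S` the prime-q atom; DATA: μ₁ > 1 ⟺ negative, μ₂ ≤ 0.14, 66/66
cells). [folklore: Birman 1961 / Schwinger 1961; finite-dimensional case = Sylvester] -/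
theorem sigNeg_sub_eq_card_of_conj (A N C : Matrix n n ℝ) (hC : Cᵀ * A * C = 1) (e : n → (n → ℝ)) (κ : n → ℝ)
    (he : ∀ i j, e i ⬝ᵥ e j = if i = j then 1 else 0) (hKe : ∀ i, (Cᵀ * N * C) *ᵥ e i = κ i • e i) :
    sigNeg (A - N).toQuadraticForm' = Fintype.card {i // 1 < κ i} := by
  rw [← sigNeg_conj (A - N) C (isUnit_det_of_conj_eq_one hC), Matrix.mul_sub, Matrix.sub_mul, hC,
    sigNeg_eq_card_of_orthonormal_eigenvectors (1 - Cᵀ * N * C) e (fun i ↦ 1 - κ i) he fun i ↦ by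
      rw [sub_mulVec, one_mulVec, hKe i, sub_smul, one_smul]]
  exact Fintype.card_congr (Equiv.subtypeEquivRight fun i ↦ sub_neg)

/-- The Mathlib instance: with `hK : (CᵀNC).IsHermitian` and its spectral-theorem eigenvalues,
`sigNeg(A − N) = #{i | 1 < hK.eigenvalues i}` whenever `CᵀAC = 1`. [folklore] -/
theorem sigNeg_sub_eq_card_eigenvalues_gt_one (A N C : Matrix n n ℝ) (hC : Cᵀ * A * C = 1)
    (hK : (Cᵀ * N * C).IsHermitian) : sigNeg (A - N).toQuadraticForm' = Fintype.card {i // 1 < hK.eigenvalues i} :=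
  sigNeg_sub_eq_card_of_conj A N C hC (fun i ↦ ⇑(hK.eigenvectorBasis i)) hK.eigenvalues (eigenvectorBasis_dotProduct hK)
    fun i ↦ hK.mulVec_eigenvectorBasis i

/-- And with `A − N` symmetric too, BOTH sides are eigenvalue counts: `#{λᵢ(A − N) < 0} = #{κᵢ(CᵀNC) > 1}`. [folklore] -/
theorem card_eigenvalues_neg_sub_eq_card_gt_one {A N C : Matrix n n ℝ} (hC : Cᵀ * A * C = 1) (hAN : (A - N).IsHermitian)
    (hK : (Cᵀ * N * C).IsHermitian) :
    Fintype.card {i // hAN.eigenvalues i < 0} = Fintype.card {i // 1 < hK.eigenvalues i} := by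
  rw [← sigNeg_eq_card_eigenvalues_neg hAN, sigNeg_sub_eq_card_eigenvalues_gt_one A N C hC hK]

/-- The `κᵢ` ARE the Birman–Schwinger eigenvalues: if `CᵀAC = 1` then `CCᵀ = A⁻¹` and `CᵀNC` has the same characteristic
polynomial as `A⁻¹N` (kappa.py's `G_F⁻¹N`, whose eigenvalues are the cell's `μⱼ`). [folklore] -/
theorem charpoly_conj_eq_charpoly_inv_mul (A N C : Matrix n n ℝ) (hC : Cᵀ * A * C = 1) :
    (Cᵀ * N * C).charpoly = (A⁻¹ * N).charpoly := by
  have h1 : A * (C * Cᵀ) = 1 := by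
    rw [← Matrix.mul_assoc, ← mul_eq_one_comm, ← Matrix.mul_assoc]
    exact hC
  have hCCt : C * Cᵀ = A⁻¹ := (Matrix.inv_eq_right_inv h1).symm
  calc (Cᵀ * N * C).charpoly = (Cᵀ * (N * C)).charpoly := by rw [Matrix.mul_assoc]
    _ = (N * C * Cᵀ).charpoly := by rw [Matrix.charpoly_mul_comm]
    _ = (N * A⁻¹).charpoly := by rw [Matrix.mul_assoc, hCCt]
    _ = (A⁻¹ * N).charpoly := Matrix.charpoly_mul_comm _ _

end BirmanSchwinger

end Summit.RiemannHypothesis.RiemannHypothesis.Theorems.HandoffInertiaCount
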